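import Summits.QuantumFields.YangMills.Theorems.UnitScaleTiltProp7SectET3DeltaPiT3PInv
import Summits.QuantumFields.YangMills.Theorems.UnitScaleTiltProp7SectET3PropagatorsReality
import Summits.QuantumFields.YangMills.Theorems.UnitScaleTiltProp7FrakGRealityDeltaOne
import HarnessLib

/-!
# Route `UnitScaleTilt`, crux K1 child «MinimiserStabilityRegPr» (stmt-QuantumFields-19200), stub `stub_existenceMinimalOrbit` (EX), route (α) — (C2′) PINV CASCADE, FILE P3
# «REALITY-PINV»: THE THREE REALITY ROWS OF THE PINV SLOT `Δ_πᴾ = Pᴾᵀ Δ^η Pᴾ` (σ-ROW, TRACELESS SECTOR, SYMMETRY) AND THE KNIT'S `h𝒢R` ∕ `hH₁R` CLAUSES AT `DeltaPiSlotP`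

Cell `ym3-torus`, width seat `ym3-torus-px3` (gen 2; EX namer ★w2-19200 g6 2026-08-28T20:47:31Z cascade P0–P6, pen (P3) «px3: REALITY-PINV»; ★★OWNER RULING g28-№4 + AMENDMENT
«(C2′) PINV TWIN»).  THEOREMS ONLY (0 `def`, 0 `sorry`); `--supports stmt-QuantumFields-19200 --as helper`; count-neutral.  YM₃ on T³ is a ladder rung (R3), NOT the Clay problem;
nothing here is a claim about the stub, the crux, d = 4 or the mass gap.

THE PRINT.  [Balaban1985BackgroundPropagators] p. 393 «The operators … are real»; (3.21)–(3.25) p. 394 (`R`, `Δ′_a`, `G′`), (3.118)–(3.120) p. 419 (`Δ_π = Pᵀ Δ P`, `P = 1 − DG′RD*`),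
(3.126) p. 420 (`H`), (3.153) p. 426 (`𝔊`); [Balaban1985Variational] (51) p. 286 «for A′ with values in 𝔤 the configuration D(A′) has values in 𝔤 also», (110)–(111) p. 294.
HONESTY CLAUSE (RULING g28-№4 AMENDMENT, binding): `G′ᴾ` (✓`Prop7SectET3DeltaPiPInv.GprimeP` = `(Δ′_a + P₀)⁻¹ − P₀`, `P₀` the orthogonal projection onto `ker D_{U₀}`) is the
Moore–Penrose pseudo-inverse of the TREE's `Δ′_a`; it differs from print's `(Δ^η_U + aQ′*Q′)⁻¹` ((3.18)∕(3.24)) by a FINITE-RANK correction (covariantly-constant gauge parameters);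
reality is insensitive to that bookkeeping (`P₀` commutes with every involution that `D_{U₀}` intertwines).

WHAT THIS FILE PROVES (sorry-free, no definition; [folklore] bookkeeping over ✓`Prop7SectET3PropagatorsReality` + lit ✓`B11Eq103H1ComplexReality`, mirroring
✓`Prop7SectET3DeltaOneT3SlotRealityRows` for `Δ₁`).  For `0 ≤ a` (the pinv letter's only hypothesis):
* §1 GENERIC: for every additive (anti-)unitary involution triple `(σE, σS, σF)` commuting with the data `D_{U₀}`, `Q(U₀)` (and `Δ^η_{U₀}` for the last): `kerDProj_comm` (`P₀`),
  ★`GprimeP_comm` (`G′ᴾ`, by ✓`greenK_map_comm` + `P₀`), ★`gaugeCorrP_comm` (`Pᴾ = 1 − DG′ᴾR_SD*`), ★★`DeltaPiP_comm` (`Δ_πᴾ`) — the texts of ✓`GprimeT_comm`∕✓`gaugeCorr_comm`∕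
  ✓`DeltaPi_comm` with `ha : 0 ≤ a` for the vacuous class; ★★`H46P_comm` — the `h46tw` letter at the pinv slot is real for the transported involutions (twin of ✓`H46_comm`,
  the engine of (P2)'s pointwise `H46P` reality row).
* §2 the σ-ROW of the slot: ★`DeltaPiSlotP_toL2_star_of_rows` (given the `QTwS` star row) and `…_of_regPr` (★w5's ✓`QTwS_star_comm_of_regPr` BY NAME).
* §3 the TRACELESS ROW of the slot: ★`trace_DeltaPiSlotP_toL2_eq_zero_of_rows` (given the `QTwS` sector rows) and `…_of_regPr` — §1 at the reflections of the traceless sectors.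
* §4 ★★★ **`frakGfR_isHermitian_traceless_at_regPr_DeltaPiSlotP`** and ★★★ **`H1f_isHermitian_traceless_at_regPr_DeltaPiSlotP`** — the EX knit's `h𝒢R`∕`hH₁R` clauses at the
  letters `frakGfR … (DeltaPiSlotP …) U₀` ∕ `H1f … (DeltaPiSlotP …) U₀`, UNCONDITIONAL at `U₀ ∈ 𝔘_k(ε₀)` in the windows `10⁹L²e ≤ 1`, `10¹²L³ε₀ ≤ 1` (the generic slot theorems
  ✓`Prop7FrakGReality.frakGfR_isHermitian_traceless_at_regPr` ∕ ✓`Prop7HfRealityTrace.H1f_isHermitian_traceless_at_regPr` fed with §2, §3 and ✓`DeltaPiP_isSymmetric`) — the texts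
  of ✓`frakGfR_isHermitian_traceless_at_regPr_DeltaPiSlot` ∕ ✓`H1f_isHermitian_traceless_at_regPr_DeltaPiSlot` with `DeltaPiSlot ↦ DeltaPiSlotP` and `ha : 0 ≤ a`.
* §5 ★★★ **`H46P_skewHermitian_traceless_at_regPr`** (+ the `_of_rows` form) — the (R-H) clause of the `h46tw` letter at the pinv slot `H46P U₀ = Hf … (DeltaPiSlotP …) U₀`, the twin of
  ✓`Prop7H46RealityClause.H46_skewHermitian_traceless_at_regPr` (slot-generic ✓`star_Hf_eq_neg_of_skew` ∕ ✓`trace_Hf_eq_zero_of_traceless` with §2, §3, ✓`DeltaPiP_isSymmetric`).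
HONEST SCOPE.  Reality bookkeeping only; no estimate; nothing of [Balaban1985BackgroundPropagators] Thm 3.11 (`hPos`) is touched; the stub stays open.

References: T. Bałaban, CMP 99 (1985) 389–434 [Balaban1985BackgroundPropagators] (p.393, (3.21)–(3.25) p.394, (3.118)–(3.120) p.419, (3.126) p.420, (3.153) p.426); CMP 102 (1985)
277–309 [Balaban1985Variational] ((51) p.286, (103) p.293, (110)–(111) p.294).
-/

set_option autoImplicit false

noncomputable section

open scoped InnerProductSpace ComplexConjugate Matrix.Norms.L2Operator BigOperators

namespace Summit.QuantumFields.YangMills.Theorems.Prop7SectET3RealityPInv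

open Literature.MathematicalPhysics.QuantumFieldTheory.Balaban1983to89
open Literature.MathematicalPhysics.QuantumFieldTheory.Balaban1983to89.T3ContinuumYM3Torus
open T3SectALandauChart (eta eta_pos)
open T3PrintedRegularMinimiser (RegPr)
open B9SectCLatticeCarrier (Bond)
open B9Eq311L2Pairing (WL2)
open B11Eq103H1Complex (SiteL2K BondL2K greenK)
open B11Eq103H1ComplexReality (greenK_map_comm starProjection_map_comm_of_anti starProjection_map_comm_of_iso)
open B11Eq115Space (NegSup NegSize JetSup)
open Summit.QuantumFields.YangMills.Theorems.Prop7SectET3Transport (periodsT3 siteEquiv bondEquiv bgOfCfg)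
open Summit.QuantumFields.YangMills.Theorems.Prop7SectET3HilbertLetters (W₂ frobEquiv toL2 toL2S toL2B QL2 DL2 DstarL2 covLapSite QL2_toL2 inner_toL2 inner_toL2B adjoint_DL2
  toL2_symm_apply)
open Summit.QuantumFields.YangMills.Theorems.Prop7SectET3GaugeProjector (QDS RS)
open Summit.QuantumFields.YangMills.Theorems.Prop7SectET3CurvedPropagators (frakGfR H1f)
open Summit.QuantumFields.YangMills.Theorems.Prop7SectET3WilsonHessian (DeltaEta DeltaEta_isSymmetric DeltaEta_toL2_star)
open Summit.QuantumFields.YangMills.Theorems.Prop7SectET3DeltaPi (laplacePrimeA)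
open Summit.QuantumFields.YangMills.Theorems.Prop7SectET3DeltaPiPInv (kerDProj GprimeP gaugeCorrP DeltaPiP DeltaPiSlotP H46P GprimeP_eq laplacePrimeA_add_kerDProj_pos
  DeltaPiP_isSymmetric DeltaPiSlotP_apply)
open Summit.QuantumFields.YangMills.Theorems.Prop7SymAvgTwSym (QTwS QTwS_star_comm_of_regPr QTwS_scalar_of_regPr QTwS_traceless_of_regPr)
open Summit.QuantumFields.YangMills.Theorems.Prop7SectET3PropagatorsReality (adjoint_comm_of_kind map_zero_of_map_add map_sub_of_map_add DstarL2_comm' laplacePrimeA_comm RS_comm Hf_comm)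
open Summit.QuantumFields.YangMills.Theorems.Prop7SectET3HilbertLettersReality (toL2_star_star toL2_star_add toL2_star_smul_real inner_toL2_star toL2S_star_star toL2S_star_add
  toL2S_star_smul_real inner_toL2S_star toL2B_star_star toL2B_star_add toL2B_star_smul_real inner_toL2B_star DL2_star_comm QL2_star_comm_of trace_DL2_apply_eq_zero)
open Summit.QuantumFields.YangMills.Theorems.Prop7H46RealityTrace (reflection_comm_of_mapsTo mapsTo_orthogonal_of_adjoint exists_smul_one_of_trace_orthogonal trace_conjTranspose_mul_smul_one
  trace_DstarL2_apply_eq_zero)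
open Summit.QuantumFields.YangMills.Theorems.Prop7WilsonHessianSectorRows (trace_DeltaEta_toL2_eq_zero)
open Summit.QuantumFields.YangMills.Theorems.Prop7FrakGReality (frakGfR_isHermitian_traceless_at_regPr)
open Summit.QuantumFields.YangMills.Theorems.Prop7HfRealityTrace (H1f_isHermitian_traceless_at_regPr trace_Hf_eq_zero_of_traceless)
open Summit.QuantumFields.YangMills.Theorems.Prop7H46Reality (star_Hf_eq_neg_of_skew)

variable (F : T3Family) (n K : ℕ) (h : n ≤ K) (c₀ cB a : ℝ) [Fact (0 < c₀)] [Fact (0 < cB)]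
variable (U₀ : GaugeField (F.P K) 0 (Matrix.specialUnitaryGroup (Fin 2) ℂ))

/-! ## §1 The pinv letters commute with every (anti-)unitary involution triple their data commute with -/

section Generic

variable (σE : BondL2K ℂ 3 (periodsT3 F K) c₀ W₂ → BondL2K ℂ 3 (periodsT3 F K) c₀ W₂)
variable (σS : SiteL2K ℂ 3 (periodsT3 F K) c₀ W₂ → SiteL2K ℂ 3 (periodsT3 F K) c₀ W₂)
variable (σF : WL2 ℂ (fun _ : PBond (F.P n) 0 => cB) W₂ → WL2 ℂ (fun _ : PBond (F.P n) 0 => cB) W₂)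

variable (hkind : ((∀ x y : BondL2K ℂ 3 (periodsT3 F K) c₀ W₂, ⟪σE x, σE y⟫_ℂ = ⟪y, x⟫_ℂ) ∧ (∀ x y : SiteL2K ℂ 3 (periodsT3 F K) c₀ W₂, ⟪σS x, σS y⟫_ℂ = ⟪y, x⟫_ℂ) ∧
      (∀ x y : WL2 ℂ (fun _ : PBond (F.P n) 0 => cB) W₂, ⟪σF x, σF y⟫_ℂ = ⟪y, x⟫_ℂ)) ∨
    ((∀ x y : BondL2K ℂ 3 (periodsT3 F K) c₀ W₂, ⟪σE x, σE y⟫_ℂ = ⟪x, y⟫_ℂ) ∧ (∀ x y : SiteL2K ℂ 3 (periodsT3 F K) c₀ W₂, ⟪σS x, σS y⟫_ℂ = ⟪x, y⟫_ℂ) ∧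
      (∀ x y : WL2 ℂ (fun _ : PBond (F.P n) 0 => cB) W₂, ⟪σF x, σF y⟫_ℂ = ⟪x, y⟫_ℂ)))
  (hEadd : ∀ x y, σE (x + y) = σE x + σE y) (hSadd : ∀ x y, σS (x + y) = σS x + σS y) (hFadd : ∀ x y, σF (x + y) = σF x + σF y)
  (hE2 : ∀ x, σE (σE x) = x) (hS2 : ∀ s, σS (σS s) = s) (hF2 : ∀ y, σF (σF y) = y)
  (hSsmul : ∀ (r : ℝ) (s : SiteL2K ℂ 3 (periodsT3 F K) c₀ W₂), σS (((r : ℝ) : ℂ) • s) = ((r : ℝ) : ℂ) • σS s)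
  (hD : ∀ s, DL2 F n K c₀ U₀ (σS s) = σE (DL2 F n K c₀ U₀ s))
  (hQ : ∀ x, QL2 F n K h c₀ cB U₀ (σE x) = σF (QL2 F n K h c₀ cB U₀ x))

include hkind hEadd hSadd hS2 hD in
/-- **`P₀` (the orthogonal projection onto `ker D_{U₀}`) IS REAL WHEN `D_{U₀}` IS**: `ker D` is `σ_S`-stable (`D(σ_S k) = σ_E(Dk) = 0`), and an (anti-)unitary additive involution
commutes with the orthogonal projection onto a stable subspace (lit ✓`starProjection_map_comm_of_anti`∕`_of_iso`). [cite: Balaban1985BackgroundPropagators, (3.21)–(3.24) p.394, p.393] -/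
theorem kerDProj_comm (s : SiteL2K ℂ 3 (periodsT3 F K) c₀ W₂) : kerDProj F n K c₀ U₀ (σS s) = σS (kerDProj F n K c₀ U₀ s) := by
  haveI : CompleteSpace (LinearMap.ker (DL2 F n K c₀ U₀)) := FiniteDimensional.complete ℂ _
  have hK : ∀ k ∈ LinearMap.ker (DL2 F n K c₀ U₀), σS k ∈ LinearMap.ker (DL2 F n K c₀ U₀) := by
    intro k hk
    rw [LinearMap.mem_ker] at hk ⊢
    rw [hD, hk, map_zero_of_map_add σE hEadd]
  rcases hkind with hk | hk
  · exact starProjection_map_comm_of_anti _ σS hSadd hk.2.1 hS2 hK s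
  · exact starProjection_map_comm_of_iso _ σS hSadd hk.2.1 hS2 hK s

set_option maxHeartbeats 400000 in
include hkind hEadd hSadd hE2 hS2 hF2 hSsmul hD hQ in
/-- ★ **`G′ᴾ = (Δ′_a + P₀)⁻¹ − P₀` IS REAL WITH ITS DATA** (`0 ≤ a`: ✓`greenK_map_comm` for the positive definite `Δ′_a + P₀`, §1 `kerDProj_comm` for `P₀`).
[cite: Balaban1985BackgroundPropagators, (3.25) p.394, p.393] -/
theorem GprimeP_comm (ha : 0 ≤ a) (s : SiteL2K ℂ 3 (periodsT3 F K) c₀ W₂) :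
    GprimeP F n K h c₀ cB a U₀ (σS s) = σS (GprimeP F n K h c₀ cB a U₀ s) := by
  have hP₀ := kerDProj_comm F n K c₀ cB U₀ σE σS σF hkind hEadd hSadd hS2 hD
  have hΔ := laplacePrimeA_comm F n K h c₀ cB a U₀ σE σS σF hkind hSadd hE2 hS2 hF2 hSsmul hD hQ
  have hsum : ∀ x, (laplacePrimeA F n K h c₀ cB a U₀ + kerDProj F n K c₀ U₀) (σS x) = σS ((laplacePrimeA F n K h c₀ cB a U₀ + kerDProj F n K c₀ U₀) x) := by
    intro x
    rw [LinearMap.add_apply, LinearMap.add_apply, hΔ, hP₀, hSadd]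
  rw [GprimeP_eq ha, LinearMap.sub_apply, LinearMap.sub_apply, hP₀, greenK_map_comm (laplacePrimeA_add_kerDProj_pos ha U₀) σS hsum s,
    map_sub_of_map_add σS hSadd]

include hkind hEadd hSadd hFadd hE2 hS2 hF2 hSsmul hD hQ in
/-- ★ **THE GAUGE CORRECTION `Pᴾ = 1 − DG′ᴾR_SD*` IS REAL WITH ITS DATA** (`0 ≤ a`). [cite: Balaban1985BackgroundPropagators, (3.119) p.419] -/
theorem gaugeCorrP_comm (ha : 0 ≤ a) (x : BondL2K ℂ 3 (periodsT3 F K) c₀ W₂) :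
    gaugeCorrP F n K h c₀ cB a U₀ (σE x) = σE (gaugeCorrP F n K h c₀ cB a U₀ x) := by
  have hDs := DstarL2_comm' F n K c₀ cB U₀ σE σS σF hkind hE2 hS2 hD
  rw [gaugeCorrP, LinearMap.sub_apply, LinearMap.sub_apply, LinearMap.id_apply, LinearMap.id_apply, LinearMap.comp_apply, LinearMap.comp_apply, LinearMap.comp_apply,
    LinearMap.comp_apply, LinearMap.comp_apply, LinearMap.comp_apply, hDs, RS_comm F n K h c₀ cB U₀ σE σS σF hkind hSadd hFadd hE2 hS2 hD hQ,
    GprimeP_comm F n K h c₀ cB a U₀ σE σS σF hkind hEadd hSadd hE2 hS2 hF2 hSsmul hD hQ ha, hD, map_sub_of_map_add σE hEadd]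

include hkind hEadd hSadd hFadd hE2 hS2 hF2 hSsmul hD hQ in
/-- ★★ **`Δ_πᴾ = Pᴾᵀ Δ^η Pᴾ` IS REAL WHEN `Δ^η_{U₀}` IS** (and the data `D`, `Q` are; `0 ≤ a`): `Pᴾ` commutes by `gaugeCorrP_comm`, `Pᴾᵀ = Pᴾ†` by ✓`adjoint_comm_of_kind`.
[cite: Balaban1985BackgroundPropagators, (3.118)–(3.120) p.419] -/
theorem DeltaPiP_comm (ha : 0 ≤ a)
    (hΔη : ∀ x, DeltaEta F n K c₀ U₀ (σE x) = σE (DeltaEta F n K c₀ U₀ x)) (x : BondL2K ℂ 3 (periodsT3 F K) c₀ W₂) :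
    DeltaPiP F n K h c₀ cB a U₀ (σE x) = σE (DeltaPiP F n K h c₀ cB a U₀ x) := by
  have hP := gaugeCorrP_comm F n K h c₀ cB a U₀ σE σS σF hkind hEadd hSadd hFadd hE2 hS2 hF2 hSsmul hD hQ ha
  have hPa : ∀ y, LinearMap.adjoint (gaugeCorrP F n K h c₀ cB a U₀) (σE y) = σE (LinearMap.adjoint (gaugeCorrP F n K h c₀ cB a U₀) y) :=
    adjoint_comm_of_kind (gaugeCorrP F n K h c₀ cB a U₀) σE σE (hkind.elim (fun hk => Or.inl ⟨hk.1, hk.1⟩) (fun hk => Or.inr ⟨hk.1, hk.1⟩)) hE2 hE2 hP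
  rw [DeltaPiP, LinearMap.comp_apply, LinearMap.comp_apply, LinearMap.comp_apply, LinearMap.comp_apply, hP, ContinuousLinearMap.coe_coe, hΔη, hPa]

include hkind hEadd hSadd hFadd hE2 hS2 hF2 hSsmul hD hQ in
/-- ★★ **THE `h46tw` LETTER AT THE PINV SLOT, `H46P U₀ = Hf … (DeltaPiSlotP …) U₀`, IS REAL FOR THE TRANSPORTED INVOLUTIONS** `σb := toL2B⁻¹ ∘ σ_F ∘ toL2B`, `σf := toL2⁻¹ ∘ σ_E ∘ toL2`:
`H46P U₀ (σb Y) = σf (H46P U₀ Y)` given only the three data rows and the triple's own properties (`0 ≤ a`) — ★w4's slot-generic ✓`Hf_comm` at `Δx := DeltaPiSlotP` with §1 `DeltaPiP_comm`;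
the twin of ✓`H46_comm` (the engine behind (P2)'s pointwise `H46P` reality row). [cite: Balaban1985Variational, (45)–(46) p.285, (51) p.286; Balaban1985BackgroundPropagators, (3.126) p.420, p.393] -/
theorem H46P_comm (ha : 0 ≤ a)
    (hEsmul : ∀ (r : ℝ) (x : BondL2K ℂ 3 (periodsT3 F K) c₀ W₂), σE (((r : ℝ) : ℂ) • x) = ((r : ℝ) : ℂ) • σE x)
    (hFsmul : ∀ (r : ℝ) (y : WL2 ℂ (fun _ : PBond (F.P n) 0 => cB) W₂), σF (((r : ℝ) : ℂ) • y) = ((r : ℝ) : ℂ) • σF y)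
    (hΔη : ∀ x, DeltaEta F n K c₀ U₀ (σE x) = σE (DeltaEta F n K c₀ U₀ x)) (Y : PBond (F.P n) 0 → Matrix (Fin 2) (Fin 2) ℂ) :
    H46P F n K h c₀ cB a U₀ ((toL2B F n cB).symm (σF (toL2B F n cB Y))) = (toL2 F K c₀).symm (σE (toL2 F K c₀ (H46P F n K h c₀ cB a U₀ Y))) :=
  Hf_comm F n K h c₀ cB a U₀ σE σS σF (DeltaPiSlotP F n K h c₀ cB a) hkind hEadd hSadd hFadd hE2 hS2 hF2 hEsmul hFsmul hD hQ
    (DeltaPiP_comm F n K h c₀ cB a U₀ σE σS σF hkind hEadd hSadd hFadd hE2 hS2 hF2 hSsmul hD hQ ha hΔη) Y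

end Generic

/-! ## §2 The σ-row of the pinv slot (conjugation triple of ✓`Prop7SectET3HilbertLettersReality`) -/

/-- ★ **THE PINV-SLOT σ-ROW `hΔx` FROM THE `QTwS` STAR ROW**: `Δ_πᴾ(U₀)(σf) = σ(Δ_πᴾ(U₀)f)`, `σ = toL2 ∘ star ∘ toL2⁻¹` (`Δ^η`'s row is p01's ✓`DeltaEta_toL2_star`).
[cite: Balaban1985BackgroundPropagators, (3.119) p.419, p.393; Balaban1985Variational, (51) p.286] -/
theorem DeltaPiSlotP_toL2_star_of_rows (ha : 0 ≤ a)
    (hQ : ∀ A : PBond (F.P K) 0 → Matrix (Fin 2) (Fin 2) ℂ, QTwS F n K h U₀ (star A) = star (QTwS F n K h U₀ A)) :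
    ∀ f : BondL2K ℂ 3 (periodsT3 F K) c₀ W₂,
      DeltaPiSlotP F n K h c₀ cB a U₀ (toL2 F K c₀ (star ((toL2 F K c₀).symm f))) = toL2 F K c₀ (star ((toL2 F K c₀).symm (DeltaPiSlotP F n K h c₀ cB a U₀ f))) :=
  DeltaPiP_comm F n K h c₀ cB a U₀ (fun f => toL2 F K c₀ (star ((toL2 F K c₀).symm f))) (fun g => toL2S F K c₀ (star ((toL2S F K c₀).symm g)))
    (fun y => toL2B F n cB (star ((toL2B F n cB).symm y))) (Or.inl ⟨inner_toL2_star, inner_toL2S_star, inner_toL2B_star⟩)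
    toL2_star_add toL2S_star_add toL2B_star_add toL2_star_star toL2S_star_star toL2B_star_star toL2S_star_smul_real (DL2_star_comm U₀) (QL2_star_comm_of U₀ hQ) ha
    (fun f => by
      have key := DeltaEta_toL2_star (F := F) (n := n) (K := K) (c₀ := c₀) U₀ ((toL2 F K c₀).symm f)
      rwa [LinearEquiv.apply_symm_apply] at key)

/-- **THE PINV-SLOT σ-ROW AT `U₀ ∈ 𝔘_k(ε₀)`** in the windows `10⁹L²e ≤ 1`, `10¹²L³ε₀ ≤ 1` (★w5's ✓`QTwS_star_comm_of_regPr` BY NAME) — UNCONDITIONAL for `0 ≤ a`.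
[cite: Balaban1985BackgroundPropagators, (3.119) p.419; Balaban1985Variational, (51) p.286] -/
theorem DeltaPiSlotP_toL2_star_of_regPr [Fact (0 < (F.L : ℝ))] [Fact (0 < ((F.L : ℝ)⁻¹) ^ (K - n))] (ha : 0 ≤ a)
    {ε₀ e : ℝ} (hε₀ : 0 < ε₀) (he : 0 < e) (hWe : 10 ^ 9 * (F.L : ℝ) ^ 2 * e ≤ 1) (hWε : 10 ^ 12 * (F.L : ℝ) ^ 3 * ε₀ ≤ 1) (hreg : RegPr F n K ε₀ U₀) :
    ∀ f : BondL2K ℂ 3 (periodsT3 F K) c₀ W₂,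
      DeltaPiSlotP F n K h c₀ cB a U₀ (toL2 F K c₀ (star ((toL2 F K c₀).symm f))) = toL2 F K c₀ (star ((toL2 F K c₀).symm (DeltaPiSlotP F n K h c₀ cB a U₀ f))) :=
  DeltaPiSlotP_toL2_star_of_rows F n K h c₀ cB a U₀ ha (QTwS_star_comm_of_regPr F h hε₀ he hWe hWε U₀ hreg)

/-! ## §3 The traceless-sector row of the pinv slot (reflection triple of ✓`Prop7H46RealityTrace`) -/

/-- ★ **THE PINV-SLOT TRACELESS ROW `hΔtr`**: traceless `A` give traceless `toL2⁻¹(Δ_πᴾ(U₀)(toL2 A))`, given the `QTwS` sector rows `hQtr`∕`hQsc` — §1 at the reflections of the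
traceless sectors (`Δ^η`'s sectors are ✓`trace_DeltaEta_toL2_eq_zero` + ✓`DeltaEta_isSymmetric`, `D`'s are p03's). [cite: Balaban1985BackgroundPropagators, (3.119) p.419, p.393; Balaban1985Variational, (51) p.286] -/
theorem trace_DeltaPiSlotP_toL2_eq_zero_of_rows (ha : 0 ≤ a)
    (hQtr : ∀ A : PBond (F.P K) 0 → Matrix (Fin 2) (Fin 2) ℂ, (∀ b, (A b).trace = 0) → ∀ c, (QTwS F n K h U₀ A c).trace = 0)
    (hQsc : ∀ c : PBond (F.P K) 0 → ℂ, ∃ d : PBond (F.P n) 0 → ℂ, QTwS F n K h U₀ (fun b => c b • (1 : Matrix (Fin 2) (Fin 2) ℂ)) = fun c' => d c' • 1) :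
    ∀ A : PBond (F.P K) 0 → Matrix (Fin 2) (Fin 2) ℂ, (∀ b, (A b).trace = 0) → ∀ b, ((toL2 F K c₀).symm (DeltaPiSlotP F n K h c₀ cB a U₀ (toL2 F K c₀ A)) b).trace = 0 := by
  intro A hA b
  -- the traceless sectors of the three carriers
  let VE : Submodule ℂ (BondL2K ℂ 3 (periodsT3 F K) c₀ W₂) :=
    { carrier := {f | ∀ b, ((toL2 F K c₀).symm f b).trace = 0}
      add_mem' := fun {f g} hf hg b => by rw [map_add, Pi.add_apply, Matrix.trace_add, hf b, hg b, add_zero]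
      zero_mem' := fun b => by rw [map_zero, Pi.zero_apply, Matrix.trace_zero]
      smul_mem' := fun r f hf b => by rw [map_smul, Pi.smul_apply, Matrix.trace_smul, hf b, smul_zero] }
  let VS : Submodule ℂ (SiteL2K ℂ 3 (periodsT3 F K) c₀ W₂) :=
    { carrier := {g | ∀ x, ((toL2S F K c₀).symm g x).trace = 0}
      add_mem' := fun {f g} hf hg x => by rw [map_add, Pi.add_apply, Matrix.trace_add, hf x, hg x, add_zero]
      zero_mem' := fun x => by rw [map_zero, Pi.zero_apply, Matrix.trace_zero]
      smul_mem' := fun r f hf x => by rw [map_smul, Pi.smul_apply, Matrix.trace_smul, hf x, smul_zero] }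
  let VF : Submodule ℂ (WL2 ℂ (fun _ : PBond (F.P n) 0 => cB) W₂) :=
    { carrier := {y | ∀ c, ((toL2B F n cB).symm y c).trace = 0}
      add_mem' := fun {f g} hf hg c => by rw [map_add, Pi.add_apply, Matrix.trace_add, hf c, hg c, add_zero]
      zero_mem' := fun c => by rw [map_zero, Pi.zero_apply, Matrix.trace_zero]
      smul_mem' := fun r f hf c => by rw [map_smul, Pi.smul_apply, Matrix.trace_smul, hf c, smul_zero] }
  haveI : CompleteSpace VE := FiniteDimensional.complete ℂ VE
  haveI : CompleteSpace VS := FiniteDimensional.complete ℂ VS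
  haveI : CompleteSpace VF := FiniteDimensional.complete ℂ VF
  -- membership through the route-carrier readings
  have memVE : ∀ A : PBond (F.P K) 0 → Matrix (Fin 2) (Fin 2) ℂ, toL2 F K c₀ A ∈ VE ↔ ∀ b, (A b).trace = 0 := fun A => by
    change (∀ b, ((toL2 F K c₀).symm (toL2 F K c₀ A) b).trace = 0) ↔ _
    rw [LinearEquiv.symm_apply_apply]
  have memVF : ∀ B : PBond (F.P n) 0 → Matrix (Fin 2) (Fin 2) ℂ, toL2B F n cB B ∈ VF ↔ ∀ c, (B c).trace = 0 := fun B => by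
    change (∀ c, ((toL2B F n cB).symm (toL2B F n cB B) c).trace = 0) ↔ _
    rw [LinearEquiv.symm_apply_apply]
  -- the complements: scalar-valued fields
  have scalar_mem_VFc : ∀ d : PBond (F.P n) 0 → ℂ, toL2B F n cB (fun c => d c • (1 : Matrix (Fin 2) (Fin 2) ℂ)) ∈ VFᗮ := by
    intro d
    rw [Submodule.mem_orthogonal]
    intro v hv
    obtain ⟨B, rfl⟩ : ∃ B, v = toL2B F n cB B := ⟨(toL2B F n cB).symm v, ((toL2B F n cB).apply_symm_apply v).symm⟩
    rw [inner_toL2B]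
    refine mul_eq_zero_of_right _ (Finset.sum_eq_zero fun c _ => trace_conjTranspose_mul_smul_one ((memVF B).1 hv c) (d c))
  have exists_scalar_of_mem_VEc : ∀ u ∈ VEᗮ, ∃ c : PBond (F.P K) 0 → ℂ, u = toL2 F K c₀ (fun b => c b • (1 : Matrix (Fin 2) (Fin 2) ℂ)) := by
    intro u hu
    obtain ⟨A, rfl⟩ : ∃ A, u = toL2 F K c₀ A := ⟨(toL2 F K c₀).symm u, ((toL2 F K c₀).apply_symm_apply u).symm⟩
    have hpt : ∀ b, ∃ c : ℂ, A b = c • (1 : Matrix (Fin 2) (Fin 2) ℂ) := by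
      intro b
      refine exists_smul_one_of_trace_orthogonal (A b) fun X hX => ?_
      have hmem : toL2 F K c₀ (Pi.single b X) ∈ VE := (memVE _).2 fun b' => by
        by_cases hb : b' = b
        · subst hb; rw [Pi.single_eq_same]; exact hX
        · rw [Pi.single_eq_of_ne hb, Matrix.trace_zero]
      have h0 := (Submodule.mem_orthogonal _ _).1 hu _ hmem
      rw [inner_toL2, Finset.sum_eq_single b (fun b' _ hb' => by rw [Pi.single_eq_of_ne hb', Matrix.conjTranspose_zero, Matrix.zero_mul, Matrix.trace_zero])
        (fun hb => (hb (Finset.mem_univ b)).elim), Pi.single_eq_same] at h0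
      have hc₀ : ((c₀ : ℝ) : ℂ) ≠ 0 := Complex.ofReal_ne_zero.2 (ne_of_gt (Fact.out : 0 < c₀))
      exact (mul_eq_zero.1 h0).resolve_left hc₀
    choose c hc using hpt
    exact ⟨c, congrArg _ (funext hc)⟩
  -- DATA ROWS in sector form
  have hD_V : ∀ g ∈ VS, DL2 F n K c₀ U₀ g ∈ VE := by
    intro g hg
    obtain ⟨l, rfl⟩ : ∃ l, g = toL2S F K c₀ l := ⟨(toL2S F K c₀).symm g, ((toL2S F K c₀).apply_symm_apply g).symm⟩
    have hl : ∀ x, (l x).trace = 0 := fun x => by have := hg x; rwa [LinearEquiv.symm_apply_apply] at this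
    exact fun b' => trace_DL2_apply_eq_zero U₀ l hl b'
  have hDstar_V : ∀ f ∈ VE, LinearMap.adjoint (DL2 F n K c₀ U₀) f ∈ VS := by
    intro f hf
    obtain ⟨A, rfl⟩ : ∃ A, f = toL2 F K c₀ A := ⟨(toL2 F K c₀).symm f, ((toL2 F K c₀).apply_symm_apply f).symm⟩
    rw [adjoint_DL2]
    exact fun x => trace_DstarL2_apply_eq_zero F n K c₀ U₀ A ((memVE A).1 hf) x
  have hD_Vc : ∀ u ∈ VSᗮ, DL2 F n K c₀ U₀ u ∈ VEᗮ := fun u hu => mapsTo_orthogonal_of_adjoint _ VS VE hDstar_V hu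
  have hQ_V : ∀ f ∈ VE, QL2 F n K h c₀ cB U₀ f ∈ VF := by
    intro f hf
    obtain ⟨A, rfl⟩ : ∃ A, f = toL2 F K c₀ A := ⟨(toL2 F K c₀).symm f, ((toL2 F K c₀).apply_symm_apply f).symm⟩
    rw [QL2_toL2]
    exact (memVF _).2 (hQtr A ((memVE A).1 hf))
  have hQ_Vc : ∀ u ∈ VEᗮ, QL2 F n K h c₀ cB U₀ u ∈ VFᗮ := by
    intro u hu
    obtain ⟨c, rfl⟩ := exists_scalar_of_mem_VEc u hu
    obtain ⟨d, hd⟩ := hQsc c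
    rw [QL2_toL2, hd]
    exact scalar_mem_VFc d
  have hΔ_V : ∀ f ∈ VE, (DeltaEta F n K c₀ U₀ : BondL2K ℂ 3 (periodsT3 F K) c₀ W₂ →ₗ[ℂ] BondL2K ℂ 3 (periodsT3 F K) c₀ W₂) f ∈ VE := by
    intro f hf
    obtain ⟨A, rfl⟩ : ∃ A, f = toL2 F K c₀ A := ⟨(toL2 F K c₀).symm f, ((toL2 F K c₀).apply_symm_apply f).symm⟩
    exact fun b' => trace_DeltaEta_toL2_eq_zero U₀ A ((memVE A).1 hf) b'
  have hΔ_Vc : ∀ u ∈ VEᗮ, (DeltaEta F n K c₀ U₀ : BondL2K ℂ 3 (periodsT3 F K) c₀ W₂ →ₗ[ℂ] BondL2K ℂ 3 (periodsT3 F K) c₀ W₂) u ∈ VEᗮ := fun u hu =>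
    mapsTo_orthogonal_of_adjoint _ VE VE (fun v hv => by rw [(DeltaEta_isSymmetric U₀).adjoint_eq]; exact hΔ_V v hv) hu
  -- the reflections intertwined by the data
  have hD : ∀ s, DL2 F n K c₀ U₀ (VS.reflection s) = VE.reflection (DL2 F n K c₀ U₀ s) := reflection_comm_of_mapsTo VS VE _ hD_V hD_Vc
  have hQ : ∀ x, QL2 F n K h c₀ cB U₀ (VE.reflection x) = VF.reflection (QL2 F n K h c₀ cB U₀ x) := reflection_comm_of_mapsTo VE VF _ hQ_V hQ_Vc
  have hΔη : ∀ x, DeltaEta F n K c₀ U₀ (VE.reflection x) = VE.reflection (DeltaEta F n K c₀ U₀ x) := fun x => by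
    have := reflection_comm_of_mapsTo VE VE _ hΔ_V hΔ_Vc x
    simpa only [ContinuousLinearMap.coe_coe] using this
  -- §1 at the unitary (reflection) triple
  have key := DeltaPiP_comm F n K h c₀ cB a U₀ (fun x => VE.reflection x) (fun s => VS.reflection s) (fun y => VF.reflection y)
    (Or.inr ⟨fun x y => VE.reflection.inner_map_map x y, fun x y => VS.reflection.inner_map_map x y, fun x y => VF.reflection.inner_map_map x y⟩)
    (fun x y => map_add _ x y) (fun x y => map_add _ x y) (fun x y => map_add _ x y)
    (fun x => VE.reflection_reflection x) (fun s => VS.reflection_reflection s) (fun y => VF.reflection_reflection y)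
    (fun r s => map_smul _ _ s) hD hQ ha hΔη (toL2 F K c₀ A)
  -- traceless `A` is fixed by `ρ_{V_E}`; hence so is `Δ_πᴾ(toL2 A)`, i.e. it is traceless
  have hAmem : toL2 F K c₀ A ∈ VE := (memVE A).2 hA
  rw [Submodule.reflection_mem_subspace_eq_self hAmem] at key
  exact ((Submodule.reflection_eq_self_iff _).1 key.symm) b

/-- **THE PINV-SLOT TRACELESS ROW AT `U₀ ∈ 𝔘_k(ε₀)`** in the windows (★w5's ✓`QTwS_traceless_of_regPr`∕✓`QTwS_scalar_of_regPr` BY NAME) — UNCONDITIONAL for `0 ≤ a`.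
[cite: Balaban1985BackgroundPropagators, (3.119) p.419; Balaban1985Variational, (51) p.286] -/
theorem trace_DeltaPiSlotP_toL2_eq_zero_of_regPr [Fact (0 < (F.L : ℝ))] [Fact (0 < ((F.L : ℝ)⁻¹) ^ (K - n))] (ha : 0 ≤ a)
    {ε₀ e : ℝ} (hε₀ : 0 < ε₀) (he : 0 < e) (hWe : 10 ^ 9 * (F.L : ℝ) ^ 2 * e ≤ 1) (hWε : 10 ^ 12 * (F.L : ℝ) ^ 3 * ε₀ ≤ 1) (hreg : RegPr F n K ε₀ U₀) :
    ∀ A : PBond (F.P K) 0 → Matrix (Fin 2) (Fin 2) ℂ, (∀ b, (A b).trace = 0) → ∀ b, ((toL2 F K c₀).symm (DeltaPiSlotP F n K h c₀ cB a U₀ (toL2 F K c₀ A)) b).trace = 0 :=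
  trace_DeltaPiSlotP_toL2_eq_zero_of_rows F n K h c₀ cB a U₀ ha (QTwS_traceless_of_regPr F h hε₀ he hWe hWε U₀ hreg) (QTwS_scalar_of_regPr F h hε₀ hWε U₀ hreg)

/-! ## §4 ★★★ The knit's `h𝒢R` and `hH₁R` clauses at the pinv slot -/

/-- ★★★ **(R-𝒢) AT THE PINV SLOT `DeltaPiSlotP` — UNCONDITIONAL** at `U₀ ∈ 𝔘_k(ε₀)` in the windows `10⁹L²e ≤ 1`, `10¹²L³ε₀ ≤ 1`, for `0 ≤ a`: Hermitian traceless (−3)-data `f` give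
Hermitian traceless (115)-fields `frakGfR … (DeltaPiSlotP …) U₀ f` — the generic slot theorem ✓`frakGfR_isHermitian_traceless_at_regPr` fed with §2, §3 and ✓`DeltaPiP_isSymmetric`.
[cite: Balaban1985Variational, (110)–(111) p.294, (51) p.286; Balaban1985BackgroundPropagators, (3.119) p.419, (3.153) p.426] -/
theorem frakGfR_isHermitian_traceless_at_regPr_DeltaPiSlotP [Fact (0 < (F.L : ℝ))] [Fact (0 < ((F.L : ℝ)⁻¹) ^ (K - n))] (ha : 0 ≤ a)
    {ε₀ e : ℝ} (hε₀ : 0 < ε₀) (he : 0 < e) (hWe : 10 ^ 9 * (F.L : ℝ) ^ 2 * e ≤ 1) (hWε : 10 ^ 12 * (F.L : ℝ) ^ 3 * ε₀ ≤ 1) (hreg : RegPr F n K ε₀ U₀) :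
    ∀ f : NegSize (F.L : ℝ) (((F.L : ℝ)⁻¹) ^ (K - n)) (fun _ : Bond 3 (periodsT3 F K) => K - n) 3 (Matrix (Fin 2) (Fin 2) ℂ),
      (∀ b, (NegSup.equiv _ _ f b).IsHermitian ∧ (NegSup.equiv _ _ f b).trace = 0) →
      ∀ b, (JetSup.equiv _ _ _ (frakGfR F n K h c₀ cB a (DeltaPiSlotP F n K h c₀ cB a) U₀ f) b).IsHermitian ∧
        (JetSup.equiv _ _ _ (frakGfR F n K h c₀ cB a (DeltaPiSlotP F n K h c₀ cB a) U₀ f) b).trace = 0 :=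
  frakGfR_isHermitian_traceless_at_regPr F n K h c₀ cB a U₀ (DeltaPiSlotP F n K h c₀ cB a) hε₀ he hWe hWε hreg
    (DeltaPiSlotP_toL2_star_of_regPr F n K h c₀ cB a U₀ ha hε₀ he hWe hWε hreg)
    (trace_DeltaPiSlotP_toL2_eq_zero_of_regPr F n K h c₀ cB a U₀ ha hε₀ he hWe hWε hreg) (DeltaPiP_isSymmetric U₀)

/-- ★★★ **`hH₁R` AT THE PINV SLOT `DeltaPiSlotP` — UNCONDITIONAL** at `U₀ ∈ 𝔘_k(ε₀)` in the windows, for `0 ≤ a`: Hermitian traceless block data `B` give Hermitian traceless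
`(H₁f … (DeltaPiSlotP …) U₀ B)(x)` — ★w4's generic ✓`H1f_isHermitian_traceless_at_regPr` fed with §2, §3 and ✓`DeltaPiP_isSymmetric`.
[cite: Balaban1985Variational, (103) p.293, (51) p.286; Balaban1985BackgroundPropagators, (3.119) p.419, (3.126) p.420] -/
theorem H1f_isHermitian_traceless_at_regPr_DeltaPiSlotP [Fact (0 < (F.L : ℝ))] [Fact (0 < ((F.L : ℝ)⁻¹) ^ (K - n))] (ha : 0 ≤ a)
    {ε₀ e : ℝ} (hε₀ : 0 < ε₀) (he : 0 < e) (hWe : 10 ^ 9 * (F.L : ℝ) ^ 2 * e ≤ 1) (hWε : 10 ^ 12 * (F.L : ℝ) ^ 3 * ε₀ ≤ 1) (hreg : RegPr F n K ε₀ U₀) :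
    ∀ B : PBond (F.P n) 0 → Matrix (Fin 2) (Fin 2) ℂ, (∀ c, (B c).IsHermitian ∧ (B c).trace = 0) →
      ∀ x : Bond 3 (periodsT3 F K), (JetSup.equiv _ _ _ (H1f F n K h c₀ cB a (DeltaPiSlotP F n K h c₀ cB a) U₀ B) x).IsHermitian ∧
        (JetSup.equiv _ _ _ (H1f F n K h c₀ cB a (DeltaPiSlotP F n K h c₀ cB a) U₀ B) x).trace = 0 :=
  H1f_isHermitian_traceless_at_regPr F n K h c₀ cB a (DeltaPiSlotP F n K h c₀ cB a) hε₀ he hWe hWε U₀ hreg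
    (DeltaPiSlotP_toL2_star_of_regPr F n K h c₀ cB a U₀ ha hε₀ he hWe hWε hreg)
    (trace_DeltaPiSlotP_toL2_eq_zero_of_regPr F n K h c₀ cB a U₀ ha hε₀ he hWe hWε hreg) (DeltaPiP_isSymmetric U₀)

/-! ## §5 ★★★ The `h46tw` letter's (R-H) clause at the pinv slot: `H46P U₀` -/

/-- ★★ **THE (R-H) CLAUSE FOR `H := H46P U₀` FROM THE `QTwS` ROWS**: skew-Hermitian traceless block data give a skew-Hermitian traceless field — the slot-generic ✓`star_Hf_eq_neg_of_skew` ∕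
✓`trace_Hf_eq_zero_of_traceless` at `Δx := DeltaPiSlotP` with §2, §3 and ✓`DeltaPiP_isSymmetric` (`Δ^η`'s own rows discharged inside); `0 ≤ a`.
[cite: Balaban1985Variational, (45)–(46) p.285, (51) p.286; Balaban1985BackgroundPropagators, (3.126) p.420, p.393] -/
theorem H46P_skewHermitian_traceless (ha : 0 ≤ a)
    (hQ : ∀ A : PBond (F.P K) 0 → Matrix (Fin 2) (Fin 2) ℂ, QTwS F n K h U₀ (star A) = star (QTwS F n K h U₀ A))
    (hQtr : ∀ A : PBond (F.P K) 0 → Matrix (Fin 2) (Fin 2) ℂ, (∀ b, (A b).trace = 0) → ∀ c, (QTwS F n K h U₀ A c).trace = 0)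
    (hQsc : ∀ c : PBond (F.P K) 0 → ℂ, ∃ d : PBond (F.P n) 0 → ℂ, QTwS F n K h U₀ (fun b => c b • (1 : Matrix (Fin 2) (Fin 2) ℂ)) = fun c' => d c' • 1) :
    ∀ Y : PBond (F.P n) 0 → Matrix (Fin 2) (Fin 2) ℂ, (∀ c, star (Y c) = -Y c ∧ (Y c).trace = 0) →
      ∀ b, star (H46P F n K h c₀ cB a U₀ Y b) = -H46P F n K h c₀ cB a U₀ Y b ∧ (H46P F n K h c₀ cB a U₀ Y b).trace = 0 :=
  fun Y hY b =>
    ⟨star_Hf_eq_neg_of_skew F n K h c₀ cB a (DeltaPiSlotP F n K h c₀ cB a) U₀ hQ (DeltaPiSlotP_toL2_star_of_rows F n K h c₀ cB a U₀ ha hQ) Y (fun c => (hY c).1) b,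
      trace_Hf_eq_zero_of_traceless F n K h c₀ cB a (DeltaPiSlotP F n K h c₀ cB a) U₀ hQtr hQsc
        (trace_DeltaPiSlotP_toL2_eq_zero_of_rows F n K h c₀ cB a U₀ ha hQtr hQsc) (DeltaPiP_isSymmetric U₀) Y (fun c => (hY c).2) b⟩

/-- ★★★ **THE (R-H) CLAUSE FOR `H := H46P U₀` — UNCONDITIONAL AT EVERY `U₀ ∈ 𝔘_k(ε₀)` IN THE TWO WINDOWS** (`0 ≤ a`): print's `H(U₀) = GQ*(QGQ*)⁻¹` at the pinv letter maps
skew-Hermitian traceless block data to skew-Hermitian traceless fields — the twin of ✓`Prop7H46RealityClause.H46_skewHermitian_traceless_at_regPr` (the `hHfR`-class row of (P2)'s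
`h46twP_letter_of_pos_normH`). [cite: Balaban1985BackgroundPropagators, p.393, (3.126) p.420; Balaban1985Variational, (45)–(46) p.285, (51) p.286] -/
theorem H46P_skewHermitian_traceless_at_regPr [Fact (0 < (F.L : ℝ))] [Fact (0 < ((F.L : ℝ)⁻¹) ^ (K - n))] (ha : 0 ≤ a)
    {ε₀ e : ℝ} (hε₀ : 0 < ε₀) (he : 0 < e) (hWe : 10 ^ 9 * (F.L : ℝ) ^ 2 * e ≤ 1) (hWε : 10 ^ 12 * (F.L : ℝ) ^ 3 * ε₀ ≤ 1) (hreg : RegPr F n K ε₀ U₀) :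
    ∀ Y : PBond (F.P n) 0 → Matrix (Fin 2) (Fin 2) ℂ, (∀ c, star (Y c) = -Y c ∧ (Y c).trace = 0) →
      ∀ b, star (H46P F n K h c₀ cB a U₀ Y b) = -H46P F n K h c₀ cB a U₀ Y b ∧ (H46P F n K h c₀ cB a U₀ Y b).trace = 0 :=
  H46P_skewHermitian_traceless F n K h c₀ cB a U₀ ha (QTwS_star_comm_of_regPr F h hε₀ he hWe hWε U₀ hreg) (QTwS_traceless_of_regPr F h hε₀ he hWe hWε U₀ hreg)
    (QTwS_scalar_of_regPr F h hε₀ hWε U₀ hreg)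

end Summit.QuantumFields.YangMills.Theorems.Prop7SectET3RealityPInv

end
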